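import Mathlib
import Literature.Geometry.Lorentzian.KerrSchild
import Literature.Barriers.FinalStateConjecture.TrappingDerivativeLossBeams

/-!
# Crux `HonestFixedRadiusSettling` · line `sojourn-needs-only-one-over-delta` · stub `stub_farExit`
# Layer H3 (a): kinematics of the chart curve of a far null ray

Helper file for `stmt-FinalStateConjecture-13550` (stub `stub_farExit`). Elementary real analysis of
a curve `z : ℝ → E4` with derivative `ż` on an interval, under the POINTWISE conclusions of the
exact-Kerr energy argument (`0 < ż⁰`, `‖ż⃗‖ ≤ (6/5) ż⁰`, `ż⁰ ≤ 10`, taken here as hypotheses):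

* `monotone_time`, `displacement_le`: chart time increases along the curve and the spatial
  displacement is at most `(6/5) ×` the elapsed chart time (mean value inequality with moving
  bound, `image_norm_le_of_norm_deriv_right_le_deriv_boundary`);
* `exists_tendsto_of_norm_deriv_le`: a curve with bounded derivative on `[t₀, T)` has a limit at
  `T⁻` (Cauchy criterion), at distance `≤ V (T − t)` from `z t`;
* `isCompact_closedPath`: the path `z([0, T))` together with its endpoint limit is contained in a
  compact set consisting of path points and the limit only;
* `exists_firstExit`: the first parameter at which a continuous curve starting inside an open set
  `Z` is outside `Z` — the curve is in `Z` before, and at the closure of `Z` then;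
* `late_of_boundary`: the LATENESS INEQUALITY — a boundary point `‖y⃗‖ = R♯(y⁰)` reached with
  displacement `≤ (6/5) y⁰` from spatial radius `‖x‖` has `y⁰ ≥ (5/16)(‖x‖ − R♯(0))` when `R♯`
  grows at slope `≤ 2`.

References: B. O'Neill, *Semi-Riemannian geometry* (1983), Ch. 5 (the escape argument this feeds);
standard real analysis (Mathlib `MeanValue`).
-/

set_option linter.dupNamespace false

noncomputable section

open Literature.Geometry.Lorentzian
open scoped Topology
open Filter Set Metric

namespace Summit.FinalStateConjecture.FinalStateConjecture.Theorems.StarvedNecks.OneOverDelta.Kinematics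

/-! ## Monotone chart time and the displacement bound -/

section Curve

variable {z v : ℝ → E4} {D : Set ℝ}

/-- The time component along the curve has derivative the time component of the velocity.
[folklore] -/
theorem hasDerivAt_apply_zero {t : ℝ} (h : HasDerivAt z (v t) t) :
    HasDerivAt (fun s ↦ z s 0) (v t 0) t :=
  ((EuclideanSpace.proj (0 : Fin 4) : E4 →L[ℝ] ℝ).hasFDerivAt.comp_hasDerivAt t h)

/-- The spatial part along the curve has derivative the spatial part of the velocity. [folklore] -/
theorem hasDerivAt_spatial {t : ℝ} (h : HasDerivAt z (v t) t) :
    HasDerivAt (fun s ↦ E4.spatial (z s)) (E4.spatial (v t)) t :=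
  (E4.spatial.hasFDerivAt.comp_hasDerivAt t h)

/-- **Chart time increases along the curve**: if `ż⁰ > 0` on an interval `D` then `t ↦ z t 0` is
monotone on `D`. [folklore] -/
theorem monotone_time (hD : D.OrdConnected) (hz : ∀ t ∈ D, HasDerivAt z (v t) t)
    (hv : ∀ t ∈ D, 0 < v t 0) : MonotoneOn (fun s ↦ z s 0) D := by
  have hconv : Convex ℝ D := hD.convex
  refine monotoneOn_of_deriv_nonneg hconv ?_ ?_ ?_
  · exact fun t ht ↦ (hasDerivAt_apply_zero (hz t ht)).continuousAt.continuousWithinAt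
  · exact fun t ht ↦ (hasDerivAt_apply_zero (hz t (interior_subset ht))).differentiableAt.differentiableWithinAt
  · intro t ht
    rw [(hasDerivAt_apply_zero (hz t (interior_subset ht))).deriv]
    exact (hv t (interior_subset ht)).le

/-- **Displacement bound**: if `‖ż⃗‖ ≤ c ż⁰` on an interval `D`, then for `s ≤ t` in `D`,
`‖z⃗(t) − z⃗(s)‖ ≤ c (z⁰(t) − z⁰(s))` (mean value inequality with the moving bound
`B = c (z⁰ − z⁰(s))`). [folklore] -/
theorem displacement_le (hD : D.OrdConnected) (hz : ∀ t ∈ D, HasDerivAt z (v t) t) {c : ℝ}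
    (hv : ∀ t ∈ D, E4.spatialNorm (v t) ≤ c * v t 0) {s t : ℝ} (hs : s ∈ D) (ht : t ∈ D)
    (hst : s ≤ t) : ‖E4.spatial (z t) - E4.spatial (z s)‖ ≤ c * (z t 0 - z s 0) := by
  have hI : Icc s t ⊆ D := hD.out hs ht
  have hfd : ∀ r ∈ Icc s t, HasDerivAt (fun r ↦ E4.spatial (z r) - E4.spatial (z s))
      (E4.spatial (v r)) r := fun r hr ↦
    (hasDerivAt_spatial (hz r (hI hr))).sub_const (E4.spatial (z s))
  have hBd : ∀ r ∈ Icc s t, HasDerivAt (fun r ↦ c * (z r 0 - z s 0)) (c * v r 0) r := fun r hr ↦ by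
    simpa using ((hasDerivAt_apply_zero (hz r (hI hr))).sub_const (z s 0)).const_mul c
  have key := image_norm_le_of_norm_deriv_right_le_deriv_boundary'
    (f := fun r ↦ E4.spatial (z r) - E4.spatial (z s)) (f' := fun r ↦ E4.spatial (v r)) (a := s) (b := t)
    (fun r hr ↦ (hfd r hr).continuousAt.continuousWithinAt)
    (fun r hr ↦ (hfd r (Ico_subset_Icc_self hr)).hasDerivWithinAt)
    (B := fun r ↦ c * (z r 0 - z s 0)) (B' := fun r ↦ c * v r 0) (by simp)
    (fun r hr ↦ (hBd r hr).continuousAt.continuousWithinAt)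
    (fun r hr ↦ (hBd r (Ico_subset_Icc_self hr)).hasDerivWithinAt)
    (fun r hr ↦ hv r (hI (Ico_subset_Icc_self hr))) (right_mem_Icc.2 hst)
  simpa using key

end Curve

/-! ## Limits at the end of a bounded parameter interval -/

/-- **A curve with bounded derivative on `[t₀, T)` converges at `T⁻`**, and the limit is at
distance `≤ V (T − t)` from `z t` (mean value inequality; Cauchy criterion in the complete space
`E4`). [folklore] -/
theorem exists_tendsto_of_norm_deriv_le {z v : ℝ → E4} {t₀ T V : ℝ} (ht₀ : t₀ < T)
    (hz : ∀ t ∈ Ico t₀ T, HasDerivAt z (v t) t) (hV : ∀ t ∈ Ico t₀ T, ‖v t‖ ≤ V) :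
    ∃ y : E4, Tendsto z (𝓝[<] T) (𝓝 y) ∧ ∀ t ∈ Ico t₀ T, ‖z t - y‖ ≤ V * (T - t) := by
  have hV0 : 0 ≤ V := (norm_nonneg _).trans (hV t₀ ⟨le_rfl, ht₀⟩)
  -- the Lipschitz estimate on `[t₀, T)`
  have hlip : ∀ s ∈ Ico t₀ T, ∀ t ∈ Ico t₀ T, ‖z t - z s‖ ≤ V * |t - s| := by
    intro s hs t ht
    have hconv : Convex ℝ (Ico t₀ T) := convex_Ico _ _
    have h := hconv.norm_image_sub_le_of_norm_hasDerivWithin_le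
      (fun r hr ↦ (hz r hr).hasDerivWithinAt) hV hs ht
    rwa [← Real.norm_eq_abs]
  -- Cauchy criterion
  haveI hne : (𝓝[<] T).NeBot := nhdsLT_neBot T
  have hcauchy : Cauchy (map z (𝓝[<] T)) := by
    rw [Metric.cauchy_iff]
    refine ⟨hne.map z, fun ε hε ↦ ?_⟩
    obtain ⟨η, hη, hηV⟩ : ∃ η > 0, V * η < ε := by
      refine ⟨ε / (2 * (V + 1)), by positivity, ?_⟩
      rw [mul_div_assoc']
      rw [div_lt_iff₀ (by positivity)]
      nlinarith
    set a := max t₀ (T - η) with ha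
    have haT : a < T := max_lt ht₀ (by linarith)
    refine ⟨z '' Ioo a T, image_mem_map (Ioo_mem_nhdsLT haT), ?_⟩
    rintro _ ⟨s, hs, rfl⟩ _ ⟨t, ht, rfl⟩
    have hs' : s ∈ Ico t₀ T := ⟨(le_max_left _ _).trans hs.1.le, hs.2⟩
    have ht' : t ∈ Ico t₀ T := ⟨(le_max_left _ _).trans ht.1.le, ht.2⟩
    rw [dist_eq_norm]
    refine (hlip t ht' s hs').trans_lt ?_
    have h1 : |s - t| < η := by
      rw [abs_lt]; constructor <;> linarith [hs.1, hs.2, ht.1, ht.2, le_max_right t₀ (T - η)]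
    calc V * |s - t| ≤ V * η := mul_le_mul_of_nonneg_left h1.le hV0
      _ < ε := hηV
  obtain ⟨y, hy⟩ := cauchy_map_iff_exists_tendsto.1 hcauchy
  refine ⟨y, hy, fun t ht ↦ ?_⟩
  -- pass to the limit in `‖z s - z t‖ ≤ V (s - t)` as `s → T⁻`
  have hlim : Tendsto (fun s ↦ ‖z s - z t‖) (𝓝[<] T) (𝓝 ‖y - z t‖) :=
    ((hy.sub tendsto_const_nhds).norm)
  have hbound : ∀ᶠ s in 𝓝[<] T, ‖z s - z t‖ ≤ V * (T - t) := by
    filter_upwards [Ioo_mem_nhdsLT ht.2] with s hs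
    have hs' : s ∈ Ico t₀ T := ⟨ht.1.trans hs.1.le, hs.2⟩
    refine (hlip t ht s hs').trans ?_
    rw [abs_of_pos (by linarith [hs.1])]
    exact mul_le_mul_of_nonneg_left (by linarith [hs.2]) hV0
  have := le_of_tendsto hlim hbound
  rwa [norm_sub_rev] at this

/-- **The closed path is compact**: if `z` is continuous on `[t₀, T)` and tends to `y` at `T⁻`,
there is a compact set containing `z([t₀, T))` and `y`, all of whose points are path points or `y`
(the image of `[t₀, T]` under the extension of `z` by `y`). [folklore] -/
theorem isCompact_closedPath {z : ℝ → E4} {t₀ T : ℝ} {y : E4} (ht₀ : t₀ < T)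
    (hz : ∀ t ∈ Ico t₀ T, ContinuousAt z t) (hy : Tendsto z (𝓝[<] T) (𝓝 y)) :
    ∃ K : Set E4, IsCompact K ∧ y ∈ K ∧ (∀ t ∈ Ico t₀ T, z t ∈ K) ∧
      ∀ q ∈ K, q = y ∨ ∃ t ∈ Ico t₀ T, q = z t := by
  classical
  set zb : ℝ → E4 := fun t ↦ if t < T then z t else y with hzb
  have hzb_lt : ∀ t, t < T → zb t = z t := fun t ht ↦ by simp [hzb, ht]
  have hzb_T : zb T = y := by simp [hzb]
  have hcont : ContinuousOn zb (Icc t₀ T) := by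
    intro t ht
    rcases ht.2.eq_or_lt with rfl | htT
    · -- at the endpoint
      have h1 : ContinuousWithinAt zb (Iio t) t := by
        have hev : zb =ᶠ[𝓝[<] t] z := by
          filter_upwards [self_mem_nhdsWithin] with s hs using hzb_lt s hs
        rw [ContinuousWithinAt, hzb_T]
        exact hy.congr' hev.symm
      have h2 : ContinuousWithinAt zb (Iic t) t := continuousWithinAt_Iio_iff_Iic.1 h1
      exact h2.mono fun s hs ↦ hs.2
    · have hev : zb =ᶠ[𝓝 t] z := by
        filter_upwards [Iio_mem_nhds htT] with s hs using hzb_lt s hs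
      exact ((hz t ⟨ht.1, htT⟩).congr_of_eventuallyEq hev).continuousWithinAt
  refine ⟨zb '' Icc t₀ T, isCompact_Icc.image_of_continuousOn hcont, ?_, ?_, ?_⟩
  · exact ⟨T, ⟨ht₀.le, le_rfl⟩, hzb_T⟩
  · exact fun t ht ↦ ⟨t, ⟨ht.1, ht.2.le⟩, hzb_lt t ht.2⟩
  · rintro q ⟨t, ht, rfl⟩
    rcases ht.2.eq_or_lt with rfl | htT
    · exact Or.inl hzb_T
    · exact Or.inr ⟨t, ⟨ht.1, htT⟩, hzb_lt t htT⟩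

/-! ## The first exit from an open set -/

/-- **First exit.** A curve continuous on `[0, a]`, starting in the open set `Z` and outside `Z` at
the parameter `a ≥ 0`, has a first exit parameter `T ∈ (0, a]`: `z T ∉ Z`, `z T ∈ closure Z`, and
`z t ∈ Z` for `0 ≤ t < T`. [folklore] -/
theorem exists_firstExit {z : ℝ → E4} {Z : Set E4} (hZ : IsOpen Z) {a : ℝ} (ha : 0 ≤ a)
    (hcont : ContinuousOn z (Icc 0 a)) (h0 : z 0 ∈ Z) (ha' : z a ∉ Z) :
    ∃ T ∈ Ioc 0 a, z T ∉ Z ∧ z T ∈ closure Z ∧ ∀ t ∈ Ico 0 T, z t ∈ Z := by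
  set A : Set ℝ := {t ∈ Icc 0 a | z t ∉ Z} with hA
  have hAc : IsClosed A := by
    have : A = Icc 0 a ∩ z ⁻¹' Zᶜ := by ext t; simp [hA]
    rw [this]
    exact hcont.preimage_isClosed_of_isClosed isClosed_Icc hZ.isClosed_compl
  have haA : a ∈ A := ⟨⟨ha, le_rfl⟩, ha'⟩
  have hne : A.Nonempty := ⟨a, haA⟩
  have hbdd : BddBelow A := ⟨0, fun t ht ↦ ht.1.1⟩
  set T := sInf A with hT
  have hTA : T ∈ A := hAc.csInf_mem hne hbdd
  have hTa : T ≤ a := csInf_le hbdd haA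
  have hT0 : 0 ≤ T := hTA.1.1
  have hbefore : ∀ t ∈ Ico 0 T, z t ∈ Z := by
    intro t ht
    by_contra hcon
    have : t ∈ A := ⟨⟨ht.1, ht.2.le.trans hTa⟩, hcon⟩
    exact absurd (csInf_le hbdd this) (not_le.2 ht.2)
  have hTpos : 0 < T := by
    rcases hT0.eq_or_lt with h | h
    · exact absurd (h ▸ h0) hTA.2
    · exact h
  refine ⟨T, ⟨hTpos, hTa⟩, hTA.2, ?_, hbefore⟩
  -- `z T` is a limit of points of `Z`
  have hc : ContinuousWithinAt z (Ico 0 T) T :=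
    (hcont T hTA.1).mono fun t ht ↦ ⟨ht.1, ht.2.le.trans hTa⟩
  have hmem : T ∈ closure (Ico 0 T) := by
    rw [closure_Ico hTpos.ne]; exact ⟨hT0, le_rfl⟩
  haveI : (𝓝[Ico 0 T] T).NeBot := mem_closure_iff_nhdsWithin_neBot.1 hmem
  exact mem_closure_of_tendsto hc.tendsto (eventually_nhdsWithin_of_forall hbefore)

/-! ## The lateness inequality at the inner boundary -/

/-- **Lateness of the exit.** Let `R♯` grow at slope `≤ 2` after time `0`. If a point `y` with
`0 ≤ y⁰` and `‖y⃗‖ ≤ R♯(y⁰)` is reached from spatial position `x` with displacement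
`‖y⃗ − x‖ ≤ (6/5) y⁰`, then `5 (‖x‖ − R♯ 0) ≤ 16 y⁰`. [folklore] -/
theorem late_of_boundary {Rs : ℝ → ℝ} (hslope : ∀ t t' : ℝ, 0 ≤ t → t ≤ t' → Rs t' ≤ Rs t + 2 * (t' - t))
    {y : E4} {x : E3} (hy0 : 0 ≤ y 0) (hyR : E4.spatialNorm y ≤ Rs (y 0))
    (hdisp : ‖E4.spatial y - x‖ ≤ 6 / 5 * y 0) : 5 * (‖x‖ - Rs 0) ≤ 16 * y 0 := by
  have h1 : Rs (y 0) ≤ Rs 0 + 2 * (y 0 - 0) := hslope 0 (y 0) le_rfl hy0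
  have h2 : ‖x‖ ≤ E4.spatialNorm y + ‖E4.spatial y - x‖ := by
    rw [E4.spatialNorm]
    have := norm_sub_le (E4.spatial y) (E4.spatial y - x)
    rwa [sub_sub_cancel] at this
  linarith

/-- **Velocity bound from the pointwise inequalities**: `0 < ż⁰ ≤ 10` and `‖ż⃗‖ ≤ (6/5) ż⁰` give
`‖ż‖ ≤ 22`. [folklore] -/
theorem norm_le_of_rate {u : E4} (h0 : 0 < u 0) (h10 : u 0 ≤ 10) (hsp : E4.spatialNorm u ≤ 6 / 5 * u 0) :
    ‖u‖ ≤ 22 := by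
  have := Literature.Barriers.FinalStateConjecture.norm_le_abs_add_spatialNorm u
  rw [abs_of_pos h0] at this
  linarith

/-- **Deciding theorem of this helper file (registered stub `farExit_displacement_le`)**: the
displacement bound with explicit binders. [folklore] -/
theorem farExit_displacement_le : ∀ (z v : ℝ → E4) (D : Set ℝ) (c s t : ℝ), D.OrdConnected → (∀ t ∈ D, HasDerivAt z (v t) t) → (∀ t ∈ D, E4.spatialNorm (v t) ≤ c * v t 0) → s ∈ D → t ∈ D → s ≤ t → ‖E4.spatial (z t) - E4.spatial (z s)‖ ≤ c * (z t 0 - z s 0) :=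
  fun _ _ _ _ _ _ hD hz hv hs ht hst ↦ displacement_le hD hz hv hs ht hst

end Summit.FinalStateConjecture.FinalStateConjecture.Theorems.StarvedNecks.OneOverDelta.Kinematics

end
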